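import Summits.QuantumFields.YangMills.Theorems.BalabanUVNodesN20CoreEdgeShellDialDeviationNecessity

/-!
# BalabanUVNodes ∕ N20 (NE7b) — the `hedge`-JOINT COMPANION, module 13P: THE DEVIATION LETTER ALONG THE KEY DIAL — (Dev) is QUASI-MONOTONE NON-DECREASING under
# coarsening (factor 2: `Dev(kr₁) ≤ Dev(kr₂ ∘ kr₁) + Dev(kr₁-sums along kr₂) ≤ 2·Dev(kr₂ ∘ kr₁)`, along every composite dial and up the window tower), MAXIMAL at the
# collapse where it IS the total times the TOTAL VARIATION of the two runs' class laws — so dag-n20-w4's class-law TV letter pays (Dev) at EVERY key reading (fraction `2r`)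
# and, with the window-key letter, N21 at v5's pin; a four-point toy where (Dev) strictly DECREASES under coarsening shows that ×1 fails

Cell `pub-ymgap` (HUMAN RULING D-0062 Track A; D-0149 width push), seat `pub-ymgap-dag-n20-w3` (WIDTH SEAT 3 of 3 on NODE n20 = NE7b) gen 7, CLAIM-2 ∕ INTENT-2
(pub-ymgap INBOX).  Filed `--kind proof --supports stmt-QuantumFields-20544 --as helper` (K3⁷ `SpineGivenEndpointR13SepCoPH`; skeleton of record v5 941dddb108cbaacf);
COUNT-NEUTRAL.  ADDITIVE — imports this lineage's module 13N `…N20CoreEdgeShellDialDeviationNecessity` (gen 7: `fibreDev_le_mismatch_add_coarseReverse`,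
`fibreDev_le_l1Dist_classMul`, `fiberSum_classMul_sub`, `fiberSum_congr_fibre`); through it modules 13L (p617153: `shellWeightBound_crOfRecord₁₃VAt_optShell_of_keyReading_of_fibreDev`),
13K (p615422: `posPart_sum_le_sum_posPart`), 13 (p608626) and dag-n20-d's K edition ∕ KTower (p608328 ∕ p610265: `classSetK₁₃`, `weightAK₁₃ ∕ weightBK₁₃`, `kr_mem_classSetK₁₃`,
`weightAK₁₃_comp`, `weightAK₁₃_window_of_le`, `Node00.windowKeySigma_windowKeySigma`); node U5d's `fiberSum`; the tree's SHAPE `ShellWeightBound` BY NAME; modifies nothing.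
[III] = [Balaban1988Convergent], [LF-I∕II] = [Balaban1989LargeFieldI∕II], [King1986] = CMP 102.

WHY.  Modules 13K ∕ 13L ∕ 13N give, in the ℓ¹ currency of stub 2's (N19′, N21) pair, `pin ⟺ (W at kr) ∧ (Dev at kr)` at every key reading `kr`, with (W) MONOTONE
NON-INCREASING along coarsening (13K).  THIS FILE tracks the other half, (Dev), along dag-n20-d's key dial and identifies it at the top:
* §1 [folklore] THE CHAIN RULE: for class maps `π₁ : S → T`, `π₂ : T → U`, fine weights `p, q ≥ 0` with `π₁`-class sums `P¹, Q¹`, `Dev(π₁) ≤ Dev(π₂∘π₁) + Dev_T(π₂; P¹, Q¹)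
  ≤ 2·Dev(π₂∘π₁)`   (★★ `fibreDev_le_comp_add_coarseDev`, ★ `coarseDev_le_fibreDev_comp`, ★★★ `fibreDev_le_two_mul_fibreDev_comp`)
  — module 13N's «class ratio ℓ¹-optimal up to the coarse reverse mismatch» at the multiplier `(P²∕Q²) ∘ π₂`, `sum_posPart_ratio_rev_le`, and descent of the outer
  layer.  NOT monotone: §1b's four-point toy has `Dev = 45` at the finer key and `37` at the coarser (merging classes can CANCEL deviation — never more than half of it).
* §1 [folklore] THE COLLAPSE: ★★★ `fibreDev_le_two_mul_collapse` — `Dev(π) ≤ 2·Σ_S (p − (Σp∕Σq)·q)⁺` for EVERY `π`; the collapse deviation is `≥ Z_p·(μ_p(S′) − μ_q(S′))` for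
  every `S′ ⊆ S` (★ `mul_classLawGap_le_collapseDev`) and `≤ r·Z_p` under the set-wise TV letter `|μ_p(S′) − μ_q(S′)| ≤ r ∀ S′ ⊆ S` (★★ `collapseDev_le_of_classLawTV`; the
  letter is dag-n20-w4's `hρ` of `exists_hybridNE7_of_target_of_classLawTV`, p609004, verbatim) — i.e. it IS `Z_p·TV(μ_p, μ_q)` — ⇒ ★★★ `fibreDev_le_of_classLawTV`: that ONE
  letter pays (Dev) at EVERY class map, fraction `2r`.
* §2 AT THE RECORD (dag-n20-d's K edition ∕ KTower BY NAME; every tuple with core provisos, `K`, `t`): ★★★ `fibreDevA_record_le_two_mul_comp` (dials `kr₁`, `kr₂`: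
  `Dev_A(kr₁) ≤ 2·Dev_A(kr₂ ∘ kr₁)`) · ★★★ `fibreDevA_record_window_le_two_mul_of_le` (floors `c ≤ c′`: `Dev_A(window c) ≤ 2·Dev_A(window c′)`) · ★★
  `fibreDevA∕B_record_le_two_mul_collapse` · ★★★ `fibreDevA∕B_record_le_of_classLawTV` (the TV letter at `(K, t)`, radius `r`, positive totals ⇒ both deviation letters at
  EVERY `kr`, fraction `2r`) · ★★★ `shellWeightBound_crOfRecord₁₃VAt_optShell_of_keyReading_of_classLawTV` — N21 AT v5's PIN from the two ℓ¹ letters at ANY key reading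
  (fraction `w`) PLUS the class-law TV letter (radius `r`): fraction `w + 2r` (module 13L's ★★★ BY NAME); N19′ there outright (module 13), N20 free at `jcut = 0`.
LOCATED (for plan g85 ∕ idea-3 ∕ CRIT-1 ∕ the n19 ∕ n20 lanes; said, not decided): along the window road the two halves of the (N19′, N21) bill move OPPOSITELY —
(W) only shrinks (13K), (Dev) at most doubles (here) — so the top of the tower is the worst case for (Dev), where it is EXACTLY `Z·TV(μ_A, μ_B)`, dag-n20-w4's currency:
the class-law road (p609004 ∕ p611539) and this key-dial road price the SAME quantity at the collapse, and this file carries the exchange rate (factor 2) down to every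
finer key reading.  Whether `TV(μ_A, μ_B)` is summable at the record — (LS) vs law-merge — is NOT decided here (cdisprove ∕ n20-w5 ∕ the caricature lanes).

HONEST FRAMING.  [folklore] finite-sum ∕ `max` arithmetic over node U5d's `fiberSum` and the tree's SHAPE `ShellWeightBound`, dag-n20-d's K edition ∕ KTower and this
lineage's modules 13 ∕ 13K ∕ 13L ∕ 13N BY NAME; count-neutral; proves NO estimate of the programme: every letter below ((W), (Dev), the TV letter) is a HYPOTHESIS,
inhabited for no Bałaban family today (A2 declared) — two-run statements at keyed classes, NOT PRINTED for `d = 4`, NOT proved, NOT refuted; the hypothesis-free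
inequalities book NOTHING about Bałaban's objects beyond `0 ≤` class weights.  Nothing of Bałaban's asserted; no `Provisos₁₃CoPH` inhabitant claimed (K0⁷ OPEN); NE7 ∕ NE7b ∕
NE7c NOT PRINTED ∕ NOT PROVED; N19 ∕ N20 ∕ N21 NOT discharged; K3⁷ NOT closed, not claimed, v5 STANDS; counts unmoved; no count claim.  One finite `𝕋⁴_{L^K}` programme at fixed
`ε = L^{−K}`, Bałaban AS PRINTED; the YM mass gap (Clay) is NOT proved by any of this — R4 closes the conditional finite-𝕋⁴ rung `BalabanLadder.UV` only; NOT ℝ⁴, NOT continuum,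
NOT OS.  No `def` ∕ `instance` ∕ `notation` ∕ `sorry` ∕ private decls.  Sources (location only): [King1986] (3.10)–(3.13); [LF-I] p.193; [LF-II] Thm 1, (1.80) p.384; [III] (2.18) p.257.
-/

noncomputable section

open Finset
open scoped BigOperators

namespace Summit.QuantumFields.YangMills.BalabanUVNodes.N20CoreEdgeShellDialDeviationTower

open Literature.MathematicalPhysics.QuantumFieldTheory.Balaban1983to89
open Literature.MathematicalPhysics.QuantumFieldTheory.Balaban1983to89.T4Continuum
open Literature.MathematicalPhysics.QuantumFieldTheory.Balaban1983to89.Node00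
open T4IndicatorShell (ShellWeightBound)
open T4HybridMatching (fiberSum sum_fiberSum fiberSum_nonneg)
open Summit.QuantumFields.BalabanUV.T4Continuum.Spine YMDAG.UVSplit
open Summit.QuantumFields.YangMills.BalabanUVNodes.N21KeyedShellWeightShellZero (weightA₁₃_nonneg weightB₁₃_nonneg)
open Summit.QuantumFields.YangMills.BalabanUVNodes.N20CoreEdgeShellDialAscent (shellWeightBound_crOfRecord₁₃VAt_optShell_of_keyReading_of_fibreDev)
open Summit.QuantumFields.YangMills.BalabanUVNodes.N20CoreEdgeShellDialAtKeyReading (posPart_sum_le_sum_posPart)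
open Summit.QuantumFields.YangMills.BalabanUVNodes.N20CoreEdgeShellDialDeviationNecessity (fiberSum_congr_fibre fiberSum_classMul_sub
  fibreDev_le_mismatch_add_coarseReverse fibreDev_le_l1Dist_classMul)

/-! ## §1 Abstract: (Dev) along a composite class map, and at the collapse (node U5d's `fiberSum`) -/

section Fibre

variable {σ ι κ : Type*} [DecidableEq ι] [DecidableEq κ]

/-- **FIBRE SUMS COMPOSE**: summing the `π₁`-fibre sums over a `π₂`-fibre gives the fibre sum of the composite map. [folklore] -/
theorem fiberSum_fiberSum {S : Finset σ} {T : Finset ι} (π₁ : σ → ι) (π₂ : ι → κ) (p : σ → ℝ) (hmaps : ∀ s ∈ S, π₁ s ∈ T) (υ : κ) :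
    fiberSum T π₂ (fiberSum S π₁ p) υ = fiberSum S (fun s => π₂ (π₁ s)) p υ := by
  unfold fiberSum
  rw [← Finset.sum_fiberwise_of_maps_to (s := S.filter fun s => π₂ (π₁ s) = υ) (t := T.filter fun τ => π₂ τ = υ) (g := π₁)
    (fun s hs => Finset.mem_filter.mpr ⟨hmaps s (Finset.mem_filter.mp hs).1, (Finset.mem_filter.mp hs).2⟩) p]
  refine Finset.sum_congr rfl fun τ hτ => Finset.sum_congr ?_ fun _ _ => rfl
  ext s
  simp only [Finset.mem_filter]
  constructor
  · rintro ⟨hs, h⟩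
    exact ⟨⟨hs, by rw [h]; exact (Finset.mem_filter.mp hτ).2⟩, h⟩
  · rintro ⟨⟨hs, _⟩, h⟩
    exact ⟨hs, h⟩

/-- Class-wise linearity (forward sign): `fiberSum (p − m(π·)·q) τ = P τ − m τ·Q τ`. [folklore] -/
theorem fiberSum_sub_classMul (S : Finset σ) (π : σ → ι) (p q : σ → ℝ) (m : ι → ℝ) (τ : ι) :
    fiberSum S π (fun s => p s - m (π s) * q s) τ = fiberSum S π p τ - m τ * fiberSum S π q τ := by
  unfold fiberSum
  rw [Finset.mul_sum, ← Finset.sum_sub_distrib]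
  exact Finset.sum_congr rfl fun s hs => by simp only [(Finset.mem_filter.mp hs).2]

/-- **DESCENT WITH CLASS-WISE MULTIPLIERS** (forward sign): `Σ_T (P − m·Q)⁺ ≤ Σ_S (p − m_{π s}·q)⁺` (`x ↦ x⁺` subadditive on each fibre; cf. module 13K). [folklore] -/
theorem sum_posPart_sub_classMul_le {S : Finset σ} {T : Finset ι} {π : σ → ι} (p q : σ → ℝ) (m : ι → ℝ) (hmaps : ∀ s ∈ S, π s ∈ T) :
    ∑ τ ∈ T, max 0 (fiberSum S π p τ - m τ * fiberSum S π q τ) ≤ ∑ s ∈ S, max 0 (p s - m (π s) * q s) := by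
  rw [← sum_fiberSum (fun s => max 0 (p s - m (π s) * q s)) hmaps]
  refine Finset.sum_le_sum fun τ _ => ?_
  rw [← fiberSum_sub_classMul S π p q m τ]
  unfold fiberSum
  exact posPart_sum_le_sum_posPart _ _

/-- `fiberSum f − fiberSum g = fiberSum (f − g)`. [folklore] -/
theorem fiberSum_sub_fiberSum (S : Finset σ) (π : σ → ι) (f g : σ → ℝ) (τ : ι) :
    fiberSum S π f τ - fiberSum S π g τ = fiberSum S π (fun s => f s - g s) τ := by
  unfold fiberSum
  rw [← Finset.sum_sub_distrib]

/-- `x⁺ − (−x)⁺ = x`. [folklore] -/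
theorem posPart_sub_posPart_neg (x : ℝ) : max 0 x - max 0 (-x) = x := by
  rcases le_total 0 x with h | h
  · rw [max_eq_right h, max_eq_left (neg_nonpos.mpr h), sub_zero]
  · rw [max_eq_left h, max_eq_right (neg_nonneg.mpr h), zero_sub, neg_neg]

omit [DecidableEq ι] in
/-- **AT A CLASS RATIO THE REVERSE ONE-SIDED DEVIATION NEVER EXCEEDS THE FORWARD ONE**: for `P ≥ 0` on `T`, `π₂ : T → U` with class ratios `R υ = P²_υ∕Q²_υ`:
`Σ_T (R(π₂ τ)·Q − P)⁺ ≤ Σ_T (P − R(π₂ τ)·Q)⁺` — EQUAL on a class with `Q² ≠ 0` (difference `R·Q² − P² = 0`); the reverse side vanishes where `Q² = 0` (`x∕0 = 0`). [folklore] -/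
theorem sum_posPart_ratio_rev_le {T : Finset ι} {U : Finset κ} {π₂ : ι → κ} (P Q : ι → ℝ) (hmaps : ∀ τ ∈ T, π₂ τ ∈ U) (hP : ∀ τ ∈ T, 0 ≤ P τ) :
    ∑ τ ∈ T, max 0 (fiberSum T π₂ P (π₂ τ) / fiberSum T π₂ Q (π₂ τ) * Q τ - P τ) ≤
      ∑ τ ∈ T, max 0 (P τ - fiberSum T π₂ P (π₂ τ) / fiberSum T π₂ Q (π₂ τ) * Q τ) := by
  rw [← sum_fiberSum (fun τ => max 0 (fiberSum T π₂ P (π₂ τ) / fiberSum T π₂ Q (π₂ τ) * Q τ - P τ)) hmaps,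
    ← sum_fiberSum (fun τ => max 0 (P τ - fiberSum T π₂ P (π₂ τ) / fiberSum T π₂ Q (π₂ τ) * Q τ)) hmaps]
  refine Finset.sum_le_sum fun υ _ => ?_
  rw [fiberSum_congr_fibre T π₂ υ (f := fun τ => max 0 (fiberSum T π₂ P (π₂ τ) / fiberSum T π₂ Q (π₂ τ) * Q τ - P τ))
      (g := fun τ => max 0 (fiberSum T π₂ P υ / fiberSum T π₂ Q υ * Q τ - P τ)) (fun τ _ hτ => by rw [hτ]),
    fiberSum_congr_fibre T π₂ υ (f := fun τ => max 0 (P τ - fiberSum T π₂ P (π₂ τ) / fiberSum T π₂ Q (π₂ τ) * Q τ))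
      (g := fun τ => max 0 (P τ - fiberSum T π₂ P υ / fiberSum T π₂ Q υ * Q τ)) (fun τ _ hτ => by rw [hτ])]
  rcases eq_or_ne (fiberSum T π₂ Q υ) 0 with hQ | hQ
  · rw [hQ, div_zero]
    refine le_of_eq_of_le (Finset.sum_eq_zero fun τ hτ => ?_) (fiberSum_nonneg (fun τ _ => le_max_left _ _) υ)
    rw [zero_mul, zero_sub]
    exact max_eq_left (neg_nonpos.mpr (hP τ (Finset.mem_filter.mp hτ).1))
  · refine le_of_sub_nonpos (le_of_eq ?_)
    rw [fiberSum_sub_fiberSum, fiberSum_congr_fibre T π₂ υ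
      (f := fun τ => max 0 (fiberSum T π₂ P υ / fiberSum T π₂ Q υ * Q τ - P τ) - max 0 (P τ - fiberSum T π₂ P υ / fiberSum T π₂ Q υ * Q τ))
      (g := fun τ => fiberSum T π₂ P υ / fiberSum T π₂ Q υ * Q τ - P τ)
      (fun τ _ _ => by
        rw [show P τ - fiberSum T π₂ P υ / fiberSum T π₂ Q υ * Q τ = -(fiberSum T π₂ P υ / fiberSum T π₂ Q υ * Q τ - P τ) by ring]
        exact posPart_sub_posPart_neg _),
      fiberSum_classMul_sub T π₂ P Q (fun _ => fiberSum T π₂ P υ / fiberSum T π₂ Q υ) υ, div_mul_cancel₀ _ hQ, sub_self]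

/-- **★★ THE CHAIN RULE**: for class maps `π₁ : S → T`, `π₂ : T → U` and fine weights `p, q ≥ 0` with `π₁`-class sums `P¹, Q¹`:
`Dev(π₁) ≤ Dev(π₂ ∘ π₁) + Dev_T(π₂; P¹, Q¹)` — deviation at the finer key ≤ deviation at the coarser key PLUS module 13L's deviation ONE LEVEL UP (module 13N's
`fibreDev_le_mismatch_add_coarseReverse` at the multiplier `(P²∕Q²) ∘ π₂`, then `sum_posPart_ratio_rev_le`; composite ratio read at any `g = π₂ ∘ π₁` on `S`). [folklore] -/
theorem fibreDev_le_comp_add_coarseDev {S : Finset σ} {T : Finset ι} {π₁ : σ → ι} (π₂ : ι → κ) (g : σ → κ) (hg : ∀ s ∈ S, π₂ (π₁ s) = g s) (p q : σ → ℝ)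
    (hmaps : ∀ s ∈ S, π₁ s ∈ T) (hp : ∀ s ∈ S, 0 ≤ p s) (hq : ∀ s ∈ S, 0 ≤ q s) :
    ∑ s ∈ S, max 0 (p s - fiberSum S π₁ p (π₁ s) / fiberSum S π₁ q (π₁ s) * q s) ≤
      ∑ s ∈ S, max 0 (p s - fiberSum T π₂ (fiberSum S π₁ p) (g s) / fiberSum T π₂ (fiberSum S π₁ q) (g s) * q s) +
        ∑ τ ∈ T, max 0 (fiberSum S π₁ p τ -
          fiberSum T π₂ (fiberSum S π₁ p) (π₂ τ) / fiberSum T π₂ (fiberSum S π₁ q) (π₂ τ) * fiberSum S π₁ q τ) := by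
  have h := fibreDev_le_mismatch_add_coarseReverse p q
    (fun τ => fiberSum T π₂ (fiberSum S π₁ p) (π₂ τ) / fiberSum T π₂ (fiberSum S π₁ q) (π₂ τ)) hmaps hq
  have hrev := sum_posPart_ratio_rev_le (U := T.image π₂) (fiberSum S π₁ p) (fiberSum S π₁ q) (fun τ hτ => Finset.mem_image_of_mem π₂ hτ)
    (fun τ _ => fiberSum_nonneg hp τ)
  have hg' : ∑ s ∈ S, max 0 (p s - fiberSum T π₂ (fiberSum S π₁ p) (π₂ (π₁ s)) / fiberSum T π₂ (fiberSum S π₁ q) (π₂ (π₁ s)) * q s) =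
      ∑ s ∈ S, max 0 (p s - fiberSum T π₂ (fiberSum S π₁ p) (g s) / fiberSum T π₂ (fiberSum S π₁ q) (g s) * q s) :=
    Finset.sum_congr rfl fun s hs => by rw [hg s hs]
  rw [hg'] at h
  exact h.trans (add_le_add le_rfl hrev)

/-- **★ THE OUTER LAYER DESCENDS**: `Dev_T(π₂; P¹, Q¹) ≤ Dev(π₂ ∘ π₁)` — the `π₁`-class sums deviate from the `π₂`-class ratio by at most the fine weights do. [folklore] -/
theorem coarseDev_le_fibreDev_comp {S : Finset σ} {T : Finset ι} {π₁ : σ → ι} (π₂ : ι → κ) (g : σ → κ) (hg : ∀ s ∈ S, π₂ (π₁ s) = g s) (p q : σ → ℝ)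
    (hmaps : ∀ s ∈ S, π₁ s ∈ T) :
    ∑ τ ∈ T, max 0 (fiberSum S π₁ p τ - fiberSum T π₂ (fiberSum S π₁ p) (π₂ τ) / fiberSum T π₂ (fiberSum S π₁ q) (π₂ τ) * fiberSum S π₁ q τ) ≤
      ∑ s ∈ S, max 0 (p s - fiberSum T π₂ (fiberSum S π₁ p) (g s) / fiberSum T π₂ (fiberSum S π₁ q) (g s) * q s) := by
  have h := sum_posPart_sub_classMul_le p q (fun τ => fiberSum T π₂ (fiberSum S π₁ p) (π₂ τ) / fiberSum T π₂ (fiberSum S π₁ q) (π₂ τ)) hmaps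
  exact h.trans (le_of_eq (Finset.sum_congr rfl fun s hs => by rw [hg s hs]))

/-- **★★★ (Dev) IS QUASI-MONOTONE NON-DECREASING UNDER COARSENING, FACTOR 2**: `Dev(π₁) ≤ 2·Dev(π₂ ∘ π₁)` for every further class map `π₂` (not monotone: §1b). [folklore] -/
theorem fibreDev_le_two_mul_fibreDev_comp {S : Finset σ} {T : Finset ι} {π₁ : σ → ι} (π₂ : ι → κ) (g : σ → κ) (hg : ∀ s ∈ S, π₂ (π₁ s) = g s) (p q : σ → ℝ)
    (hmaps : ∀ s ∈ S, π₁ s ∈ T) (hp : ∀ s ∈ S, 0 ≤ p s) (hq : ∀ s ∈ S, 0 ≤ q s) :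
    ∑ s ∈ S, max 0 (p s - fiberSum S π₁ p (π₁ s) / fiberSum S π₁ q (π₁ s) * q s) ≤
      2 * ∑ s ∈ S, max 0 (p s - fiberSum T π₂ (fiberSum S π₁ p) (g s) / fiberSum T π₂ (fiberSum S π₁ q) (g s) * q s) := by
  rw [two_mul]
  exact (fibreDev_le_comp_add_coarseDev π₂ g hg p q hmaps hp hq).trans (add_le_add le_rfl (coarseDev_le_fibreDev_comp π₂ g hg p q hmaps))

/-- **AT THE COLLAPSE THE REVERSE DEVIATION NEVER EXCEEDS THE FORWARD ONE**: `Σ_S ((Z_p∕Z_q)·q − p)⁺ ≤ Σ_S (p − (Z_p∕Z_q)·q)⁺`, `p ≥ 0` (`=` if `Z_q ≠ 0`). [folklore] -/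
theorem sum_posPart_collapse_rev_le (S : Finset σ) (p q : σ → ℝ) (hp : ∀ s ∈ S, 0 ≤ p s) :
    ∑ s ∈ S, max 0 ((∑ s ∈ S, p s) / (∑ s ∈ S, q s) * q s - p s) ≤ ∑ s ∈ S, max 0 (p s - (∑ s ∈ S, p s) / (∑ s ∈ S, q s) * q s) := by
  rcases eq_or_ne (∑ s ∈ S, q s) 0 with hQ | hQ
  · rw [hQ, div_zero]
    refine le_of_eq_of_le (Finset.sum_eq_zero fun s hs => ?_) (Finset.sum_nonneg fun _ _ => le_max_left _ _)
    rw [zero_mul, zero_sub]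
    exact max_eq_left (neg_nonpos.mpr (hp s hs))
  · refine le_of_sub_nonpos (le_of_eq ?_)
    rw [← Finset.sum_sub_distrib]
    calc ∑ s ∈ S, (max 0 ((∑ s ∈ S, p s) / (∑ s ∈ S, q s) * q s - p s) - max 0 (p s - (∑ s ∈ S, p s) / (∑ s ∈ S, q s) * q s))
        = ∑ s ∈ S, ((∑ s ∈ S, p s) / (∑ s ∈ S, q s) * q s - p s) := Finset.sum_congr rfl fun s _ => by
          rw [show p s - (∑ s ∈ S, p s) / (∑ s ∈ S, q s) * q s = -((∑ s ∈ S, p s) / (∑ s ∈ S, q s) * q s - p s) by ring]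
          exact posPart_sub_posPart_neg _
      _ = 0 := by rw [Finset.sum_sub_distrib, ← Finset.mul_sum, div_mul_cancel₀ _ hQ, sub_self]

/-- **★★★ (Dev) IS MAXIMAL AT THE COLLAPSE, FACTOR 2**: for EVERY class map `π` and `p, q ≥ 0`, `Dev(π) ≤ 2·Σ_S (p − (Σ_S p∕Σ_S q)·q)⁺` — twice the deviation of `S`
read as ONE class (module 13N's ℓ¹-distance bound at the constant `Z_p∕Z_q`, then the collapse balance). [folklore] -/
theorem fibreDev_le_two_mul_collapse (S : Finset σ) (π : σ → ι) (p q : σ → ℝ) (hp : ∀ s ∈ S, 0 ≤ p s) (hq : ∀ s ∈ S, 0 ≤ q s) :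
    ∑ s ∈ S, max 0 (p s - fiberSum S π p (π s) / fiberSum S π q (π s) * q s) ≤ 2 * ∑ s ∈ S, max 0 (p s - (∑ s ∈ S, p s) / (∑ s ∈ S, q s) * q s) := by
  have h := fibreDev_le_l1Dist_classMul S π p q (fun _ => (∑ s ∈ S, p s) / (∑ s ∈ S, q s)) hq
  have hrev := sum_posPart_collapse_rev_le S p q hp
  linarith

/-- **★ THE COLLAPSE DEVIATION DOMINATES EVERY CLASS-LAW GAP**: `Z_p·(μ_p(S′) − μ_q(S′)) ≤ Σ_S (p − (Z_p∕Z_q)·q)⁺` for `S′ ⊆ S` (so it is `≥ Z_p·TV(μ_p, μ_q)`). [folklore] -/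
theorem mul_classLawGap_le_collapseDev (S : Finset σ) (p q : σ → ℝ) {S' : Finset σ} (hS' : S' ⊆ S) (hZp : 0 < ∑ s ∈ S, p s) (hZq : 0 < ∑ s ∈ S, q s) :
    (∑ s ∈ S, p s) * ((∑ s ∈ S', p s) / (∑ s ∈ S, p s) - (∑ s ∈ S', q s) / (∑ s ∈ S, q s)) ≤
      ∑ s ∈ S, max 0 (p s - (∑ s ∈ S, p s) / (∑ s ∈ S, q s) * q s) := by
  have hlin : (∑ s ∈ S, p s) * ((∑ s ∈ S', p s) / (∑ s ∈ S, p s) - (∑ s ∈ S', q s) / (∑ s ∈ S, q s)) =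
      ∑ s ∈ S', (p s - (∑ s ∈ S, p s) / (∑ s ∈ S, q s) * q s) := by
    rw [Finset.sum_sub_distrib, ← Finset.mul_sum]
    field_simp
  rw [hlin]
  exact (Finset.sum_le_sum fun s _ => le_max_right 0 _).trans
    (Finset.sum_le_sum_of_subset_of_nonneg hS' fun s _ _ => le_max_left _ _)

/-- **★★ … AND IS PAID BY THE CLASS-LAW TV LETTER**: positive totals and `|μ_p(S′) − μ_q(S′)| ≤ r` for all `S′ ⊆ S` (dag-n20-w4's `hρ` shape, p609004) give
`Σ_S (p − (Z_p∕Z_q)·q)⁺ ≤ r·Z_p` (the letter read at the POSITIVE SET, where the one-sided sum is attained): the collapse deviation is EXACTLY `Z_p·TV(μ_p, μ_q)`. [folklore] -/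
theorem collapseDev_le_of_classLawTV (S : Finset σ) (p q : σ → ℝ) {r : ℝ} (hZp : 0 < ∑ s ∈ S, p s) (hZq : 0 < ∑ s ∈ S, q s)
    (hTV : ∀ S' ⊆ S, |(∑ s ∈ S', p s) / (∑ s ∈ S, p s) - (∑ s ∈ S', q s) / (∑ s ∈ S, q s)| ≤ r) :
    ∑ s ∈ S, max 0 (p s - (∑ s ∈ S, p s) / (∑ s ∈ S, q s) * q s) ≤ r * ∑ s ∈ S, p s := by
  set m : ℝ := (∑ s ∈ S, p s) / (∑ s ∈ S, q s) with hm
  have hpos : ∑ s ∈ S, max 0 (p s - m * q s) = ∑ s ∈ S.filter (fun s => 0 ≤ p s - m * q s), (p s - m * q s) := by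
    rw [Finset.sum_filter]
    exact Finset.sum_congr rfl fun s _ => by
      split_ifs with h
      · exact max_eq_right h
      · exact max_eq_left (le_of_lt (not_le.mp h))
  have hgap := mul_le_mul_of_nonneg_left (le_of_abs_le (hTV _ (Finset.filter_subset (fun s => 0 ≤ p s - m * q s) S))) hZp.le
  have hZp' := hZp.ne'
  have hZq' := hZq.ne'
  have key : ∀ X Y : ℝ, (∑ s ∈ S, p s) * (X / (∑ s ∈ S, p s) - Y / (∑ s ∈ S, q s)) = X - m * Y := fun X Y => by
    rw [hm]
    field_simp
  have hlin : (∑ s ∈ S, p s) * ((∑ s ∈ S.filter (fun s => 0 ≤ p s - m * q s), p s) / (∑ s ∈ S, p s) -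
      (∑ s ∈ S.filter (fun s => 0 ≤ p s - m * q s), q s) / (∑ s ∈ S, q s)) =
      ∑ s ∈ S.filter (fun s => 0 ≤ p s - m * q s), (p s - m * q s) := by
    rw [Finset.sum_sub_distrib, ← Finset.mul_sum]
    exact key _ _
  rw [hpos, ← hlin, mul_comm r]
  exact hgap

/-- **★★★ THE CLASS-LAW TV LETTER PAYS (Dev) AT EVERY CLASS MAP, FRACTION `2r`**: positive totals, `p, q ≥ 0`, `|μ_p(S′) − μ_q(S′)| ≤ r ∀ S′ ⊆ S` ⇒ `Dev(π) ≤ 2r·Σ_S p`. -/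
theorem fibreDev_le_of_classLawTV (S : Finset σ) (π : σ → ι) (p q : σ → ℝ) {r : ℝ} (hp : ∀ s ∈ S, 0 ≤ p s) (hq : ∀ s ∈ S, 0 ≤ q s)
    (hZp : 0 < ∑ s ∈ S, p s) (hZq : 0 < ∑ s ∈ S, q s)
    (hTV : ∀ S' ⊆ S, |(∑ s ∈ S', p s) / (∑ s ∈ S, p s) - (∑ s ∈ S', q s) / (∑ s ∈ S, q s)| ≤ r) :
    ∑ s ∈ S, max 0 (p s - fiberSum S π p (π s) / fiberSum S π q (π s) * q s) ≤ 2 * r * ∑ s ∈ S, p s := by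
  have h1 := fibreDev_le_two_mul_collapse S π p q hp hq
  have h2 := collapseDev_le_of_classLawTV S p q hZp hZq hTV
  linarith

end Fibre

/-! ### §1b Toy: (Dev) is NOT monotone under coarsening — four points, two classes merged into one: `45 → 37` (strict decrease, within the factor 2: `45 ≤ 74`) -/

section Toy

/-- TOY (`Fin 4`; `p = (180, 0, 153, 47)`, `q = (90, 10, 90, 10)`; classes `{0,1}` (ratio `1.8`), `{2,3}` (ratio `2`)): finer deviation `18 + 0 + 0 + 27 = 45`. -/
theorem toy_fibreDev_fine :
    ∑ s : Fin 4, max 0 ((![180, 0, 153, 47] : Fin 4 → ℝ) s -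
        fiberSum Finset.univ (![true, true, false, false] : Fin 4 → Bool) (![180, 0, 153, 47] : Fin 4 → ℝ) ((![true, true, false, false] : Fin 4 → Bool) s) /
          fiberSum Finset.univ (![true, true, false, false] : Fin 4 → Bool) (![90, 10, 90, 10] : Fin 4 → ℝ) ((![true, true, false, false] : Fin 4 → Bool) s) *
            (![90, 10, 90, 10] : Fin 4 → ℝ) s) = 45 := by
  simp only [fiberSum, Finset.sum_filter, Fin.sum_univ_four, Matrix.cons_val_zero, Matrix.cons_val_one, Matrix.cons_val, Fin.isValue,
    Bool.true_eq_false, Bool.false_eq_true, if_true, if_false]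
  norm_num

/-- TOY, coarser key (one class, ratio `1.9`): `9 + 0 + 0 + 28 = 37 < 45` — merging the classes CANCELLED deviation: (Dev) strictly decreased, by less than half. -/
theorem toy_fibreDev_coarse :
    ∑ s : Fin 4, max 0 ((![180, 0, 153, 47] : Fin 4 → ℝ) s -
        (∑ s : Fin 4, (![180, 0, 153, 47] : Fin 4 → ℝ) s) / (∑ s : Fin 4, (![90, 10, 90, 10] : Fin 4 → ℝ) s) * (![90, 10, 90, 10] : Fin 4 → ℝ) s) = 37 := by
  simp only [Fin.sum_univ_four, Matrix.cons_val_zero, Matrix.cons_val_one, Matrix.cons_val, Fin.isValue]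
  norm_num

end Toy

/-! ## §2 At the record: along composite dials and the window tower; the collapse; dag-n20-w4's TV letter pays (Dev) at every key reading and, with (W), N21 at the pin -/

section Tower

variable {F : T4Family} {N : ℕ} [NeZero N] (θ : Stage13HParams F N) (hP : θ.Provisos₁₃CoPH F N) (K₀ : ℕ) (g₀ : ℕ → ℝ) (os : List (ULoop F))

/-- **★★★ (Dev) ALONG A COMPOSITE DIAL AT THE RECORD, run A**: for every pair of per-tuple dials `kr₁`, `kr₂` and every `K`, `t`, module 13L's run-A deviation at `kr₁` is
at most TWICE the one at the composite dial `kr₂ ∘ kr₁` (KTower `weightAK₁₃_comp ∕ weightBK₁₃_comp`; §1 ★★★): along the key dial (Dev) grows at most twofold. [bookkeeping] -/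
theorem fibreDevA_record_le_two_mul_comp (kr₁ kr₂ : ℕ → (Σ K, SiteSeqKey F (K₀ + K)) → (Σ K, SiteSeqKey F (K₀ + K))) (K : ℕ) (t : ℝ) :
    ∑ x ∈ classSet₁₃ θ K₀ g₀ K, max 0 (weightA₁₃ θ hP K₀ g₀ os K t x -
        weightAK₁₃ θ hP K₀ g₀ os kr₁ K t (kr₁ K x) / weightBK₁₃ θ hP K₀ g₀ os kr₁ K t (kr₁ K x) * weightB₁₃ θ hP K₀ g₀ os K t x) ≤
      2 * ∑ x ∈ classSet₁₃ θ K₀ g₀ K, max 0 (weightA₁₃ θ hP K₀ g₀ os K t x -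
        weightAK₁₃ θ hP K₀ g₀ os (fun K x => kr₂ K (kr₁ K x)) K t (kr₂ K (kr₁ K x)) /
            weightBK₁₃ θ hP K₀ g₀ os (fun K x => kr₂ K (kr₁ K x)) K t (kr₂ K (kr₁ K x)) * weightB₁₃ θ hP K₀ g₀ os K t x) := by
  letI : ∀ Kc, DecidableEq (SiteSeqKey F Kc) := fun _ => Classical.decEq _
  simp only [weightAK₁₃_comp θ hP K₀ g₀ os kr₁ kr₂, weightBK₁₃_comp θ hP K₀ g₀ os kr₁ kr₂]
  exact fibreDev_le_two_mul_fibreDev_comp (S := classSet₁₃ θ K₀ g₀ K) (T := classSetK₁₃ θ K₀ g₀ kr₁ K) (π₁ := kr₁ K) (kr₂ K)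
    (fun x => kr₂ K (kr₁ K x)) (fun _ _ => rfl) (weightA₁₃ θ hP K₀ g₀ os K t) (weightB₁₃ θ hP K₀ g₀ os K t)
    (fun x hx => kr_mem_classSetK₁₃ θ K₀ g₀ kr₁ hx) (fun x _ => weightA₁₃_nonneg F θ hP K₀ g₀ os K t x) (fun x _ => weightB₁₃_nonneg F θ hP K₀ g₀ os K t x)

/-- **★★★ (Dev) UP THE WINDOW TOWER, run A**: for floors `c ≤ c′` at every step, the run-A deviation at the floor-`c` window is at most TWICE the one at the floor-`c′`
window (KTower `weightAK₁₃_window_of_le` + `Node00.windowKeySigma_windowKeySigma`: the windows compose to floor `max c c′ = c′`); with module 13K's `mismatch_window_of_le`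
((W) only SHRINKS up the tower) the two halves of the bill move oppositely. [cite: Balaban1989LargeFieldII, (1.80) p.384 (the window — bookkeeping only)] [bookkeeping] -/
theorem fibreDevA_record_window_le_two_mul_of_le (c c' : ℕ → ℕ) (h : ∀ K, c K ≤ c' K) (K : ℕ) (t : ℝ) :
    ∑ x ∈ classSet₁₃ θ K₀ g₀ K, max 0 (weightA₁₃ θ hP K₀ g₀ os K t x -
        weightAK₁₃ θ hP K₀ g₀ os (fun _ x => windowKeySigma F c x) K t (windowKeySigma F c x) /
            weightBK₁₃ θ hP K₀ g₀ os (fun _ x => windowKeySigma F c x) K t (windowKeySigma F c x) * weightB₁₃ θ hP K₀ g₀ os K t x) ≤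
      2 * ∑ x ∈ classSet₁₃ θ K₀ g₀ K, max 0 (weightA₁₃ θ hP K₀ g₀ os K t x -
        weightAK₁₃ θ hP K₀ g₀ os (fun _ x => windowKeySigma F c' x) K t (windowKeySigma F c' x) /
            weightBK₁₃ θ hP K₀ g₀ os (fun _ x => windowKeySigma F c' x) K t (windowKeySigma F c' x) * weightB₁₃ θ hP K₀ g₀ os K t x) := by
  letI : ∀ Kc, DecidableEq (SiteSeqKey F Kc) := fun _ => Classical.decEq _
  have hmax : (fun K => max (c K) (c' K)) = c' := funext fun K => max_eq_right (h K)
  simp only [weightAK₁₃_window_of_le θ hP K₀ g₀ os c c' h, weightBK₁₃_window_of_le θ hP K₀ g₀ os c c' h]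
  exact fibreDev_le_two_mul_fibreDev_comp (S := classSet₁₃ θ K₀ g₀ K) (T := classSetK₁₃ θ K₀ g₀ (fun _ x => windowKeySigma F c x) K)
    (π₁ := fun x => windowKeySigma F c x) (fun x => windowKeySigma F c' x) (fun x => windowKeySigma F c' x)
    (fun x _ => by simp only [windowKeySigma_windowKeySigma F c c' x, hmax]) (weightA₁₃ θ hP K₀ g₀ os K t) (weightB₁₃ θ hP K₀ g₀ os K t)
    (fun x hx => kr_mem_classSetK₁₃ θ K₀ g₀ (fun _ x => windowKeySigma F c x) hx)
    (fun x _ => weightA₁₃_nonneg F θ hP K₀ g₀ os K t x) (fun x _ => weightB₁₃_nonneg F θ hP K₀ g₀ os K t x)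

end Tower

section Record

variable {F : T4Family} {N : ℕ} [NeZero N] (K₀ : ℕ) (kr : KeyReading₁₃ N K₀) (θ : Stage13HParams F N) (hP : θ.Provisos₁₃CoPH F N)
  (g₀ : ℕ → ℝ) (os : List (ULoop F))

/-- **★★ (Dev) IS MAXIMAL AT THE COLLAPSE, AT THE RECORD** (run A; run B by `A ↔ B`): for every key reading `kr`, tuple, `K`, `t`, the run-A deviation at `kr` is at most
TWICE the collapse deviation `Σ_{classSet₁₃} (weightA₁₃ − (Σ weightA₁₃ ∕ Σ weightB₁₃)·weightB₁₃)⁺` (= `Z_A·TV(μ_A, μ_B)` for positive totals, §1 ★ ∕ ★★). [bookkeeping] -/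
theorem fibreDevA_record_le_two_mul_collapse (K : ℕ) (t : ℝ) :
    ∑ x ∈ classSet₁₃ θ K₀ g₀ K, max 0 (weightA₁₃ θ hP K₀ g₀ os K t x -
        weightAK₁₃ θ hP K₀ g₀ os (kr F θ hP g₀ os) K t (kr F θ hP g₀ os K x) / weightBK₁₃ θ hP K₀ g₀ os (kr F θ hP g₀ os) K t (kr F θ hP g₀ os K x) *
          weightB₁₃ θ hP K₀ g₀ os K t x) ≤
      2 * ∑ x ∈ classSet₁₃ θ K₀ g₀ K, max 0 (weightA₁₃ θ hP K₀ g₀ os K t x -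
        (∑ x ∈ classSet₁₃ θ K₀ g₀ K, weightA₁₃ θ hP K₀ g₀ os K t x) / (∑ x ∈ classSet₁₃ θ K₀ g₀ K, weightB₁₃ θ hP K₀ g₀ os K t x) *
          weightB₁₃ θ hP K₀ g₀ os K t x) := by
  letI : ∀ Kc, DecidableEq (SiteSeqKey F Kc) := fun _ => Classical.decEq _
  exact fibreDev_le_two_mul_collapse (classSet₁₃ θ K₀ g₀ K) (kr F θ hP g₀ os K) (weightA₁₃ θ hP K₀ g₀ os K t) (weightB₁₃ θ hP K₀ g₀ os K t)
    (fun x _ => weightA₁₃_nonneg F θ hP K₀ g₀ os K t x) (fun x _ => weightB₁₃_nonneg F θ hP K₀ g₀ os K t x)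

/-- **★★★ dag-n20-w4's CLASS-LAW TV LETTER PAYS THE run-A DEVIATION LETTER AT EVERY KEY READING, fraction `2r`**: at `(K, t)`, positive totals and the set-wise letter
`|Σ_{S′} weightA₁₃ ∕ Σ weightA₁₃ − Σ_{S′} weightB₁₃ ∕ Σ weightB₁₃| ≤ r` for all `S′ ⊆ classSet₁₃` (p609004's `hρ` shape at this `(K, t)`) ⇒ module 13L's run-A deviation letter
at `kr` with fraction `2·r`.  The TV letter is a two-run statement — NOT PRINTED for `d = 4`, NOT proved. [bookkeeping] -/
theorem fibreDevA_record_le_of_classLawTV {r : ℝ} {K : ℕ} {t : ℝ}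
    (hZA : 0 < ∑ x ∈ classSet₁₃ θ K₀ g₀ K, weightA₁₃ θ hP K₀ g₀ os K t x) (hZB : 0 < ∑ x ∈ classSet₁₃ θ K₀ g₀ K, weightB₁₃ θ hP K₀ g₀ os K t x)
    (hTV : ∀ S' ⊆ classSet₁₃ θ K₀ g₀ K,
      |(∑ x ∈ S', weightA₁₃ θ hP K₀ g₀ os K t x) / (∑ x ∈ classSet₁₃ θ K₀ g₀ K, weightA₁₃ θ hP K₀ g₀ os K t x) -
        (∑ x ∈ S', weightB₁₃ θ hP K₀ g₀ os K t x) / (∑ x ∈ classSet₁₃ θ K₀ g₀ K, weightB₁₃ θ hP K₀ g₀ os K t x)| ≤ r) :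
    ∑ x ∈ classSet₁₃ θ K₀ g₀ K, max 0 (weightA₁₃ θ hP K₀ g₀ os K t x -
        weightAK₁₃ θ hP K₀ g₀ os (kr F θ hP g₀ os) K t (kr F θ hP g₀ os K x) / weightBK₁₃ θ hP K₀ g₀ os (kr F θ hP g₀ os) K t (kr F θ hP g₀ os K x) *
          weightB₁₃ θ hP K₀ g₀ os K t x) ≤
      2 * r * ∑ x ∈ classSet₁₃ θ K₀ g₀ K, weightA₁₃ θ hP K₀ g₀ os K t x := by
  letI : ∀ Kc, DecidableEq (SiteSeqKey F Kc) := fun _ => Classical.decEq _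
  exact fibreDev_le_of_classLawTV (classSet₁₃ θ K₀ g₀ K) (kr F θ hP g₀ os K) (weightA₁₃ θ hP K₀ g₀ os K t) (weightB₁₃ θ hP K₀ g₀ os K t)
    (fun x _ => weightA₁₃_nonneg F θ hP K₀ g₀ os K t x) (fun x _ => weightB₁₃_nonneg F θ hP K₀ g₀ os K t x) hZA hZB hTV

/-- **★★★ … AND THE run-B DEVIATION LETTER** (the same letter, `|·|` symmetric). [bookkeeping] -/
theorem fibreDevB_record_le_of_classLawTV {r : ℝ} {K : ℕ} {t : ℝ}
    (hZA : 0 < ∑ x ∈ classSet₁₃ θ K₀ g₀ K, weightA₁₃ θ hP K₀ g₀ os K t x) (hZB : 0 < ∑ x ∈ classSet₁₃ θ K₀ g₀ K, weightB₁₃ θ hP K₀ g₀ os K t x)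
    (hTV : ∀ S' ⊆ classSet₁₃ θ K₀ g₀ K,
      |(∑ x ∈ S', weightA₁₃ θ hP K₀ g₀ os K t x) / (∑ x ∈ classSet₁₃ θ K₀ g₀ K, weightA₁₃ θ hP K₀ g₀ os K t x) -
        (∑ x ∈ S', weightB₁₃ θ hP K₀ g₀ os K t x) / (∑ x ∈ classSet₁₃ θ K₀ g₀ K, weightB₁₃ θ hP K₀ g₀ os K t x)| ≤ r) :
    ∑ x ∈ classSet₁₃ θ K₀ g₀ K, max 0 (weightB₁₃ θ hP K₀ g₀ os K t x -
        weightBK₁₃ θ hP K₀ g₀ os (kr F θ hP g₀ os) K t (kr F θ hP g₀ os K x) / weightAK₁₃ θ hP K₀ g₀ os (kr F θ hP g₀ os) K t (kr F θ hP g₀ os K x) *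
          weightA₁₃ θ hP K₀ g₀ os K t x) ≤
      2 * r * ∑ x ∈ classSet₁₃ θ K₀ g₀ K, weightB₁₃ θ hP K₀ g₀ os K t x := by
  letI : ∀ Kc, DecidableEq (SiteSeqKey F Kc) := fun _ => Classical.decEq _
  exact fibreDev_le_of_classLawTV (classSet₁₃ θ K₀ g₀ K) (kr F θ hP g₀ os K) (weightB₁₃ θ hP K₀ g₀ os K t) (weightA₁₃ θ hP K₀ g₀ os K t)
    (fun x _ => weightB₁₃_nonneg F θ hP K₀ g₀ os K t x) (fun x _ => weightA₁₃_nonneg F θ hP K₀ g₀ os K t x) hZB hZA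
    (fun S' hS' => by rw [abs_sub_comm]; exact hTV S' hS')

variable (jcut : ℕ → ℕ) (sh : ShellSplit₁₃CoPH N K₀) (c : ℕ → ℝ)

/-- **★★★ N21 AT v5's PINNED READING FROM THE WINDOW-KEY LETTERS PLUS dag-n20-w4's CLASS-LAW TV LETTER** — the two N20 width roads composed: `sh⋆` module 13's
ℓ¹-optimal split of the FINE weights at constants `c`, summable `w ≥ 0` carrying module 13K §2's two letters for the `kr`-COARSE weights (ANY `kr`), positive totals, a
summable radius `r ≥ 0` carrying the set-wise TV letter at the PIN ⇒ `ShellWeightBound` at `crOfRecord₁₃VAt K₀ jcut sh⋆`, canonical `Wsh` (module 13L's ★★★ BY NAME at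
deviation fraction `2r`); N19′ there outright (module 13), N20 free at `jcut = 0`.  All three letters are two-run statements — NOT PRINTED for `d = 4`, NOT proved.
[cite: Balaban1989LargeFieldII, Thm 1 + (0.1) pp.355–356, (1.80) p.384 (templates only)] [bookkeeping] -/
theorem shellWeightBound_crOfRecord₁₃VAt_optShell_of_keyReading_of_classLawTV {w r : ℕ → ℝ}
    (hsh : sh F θ hP g₀ os =
      (fun K t x => max 0 (weightA₁₃ θ hP K₀ g₀ os K t x - Real.exp (-c K) * weightB₁₃ θ hP K₀ g₀ os K t x),
       fun K t x => max 0 (weightB₁₃ θ hP K₀ g₀ os K t x - Real.exp (c K) * weightA₁₃ θ hP K₀ g₀ os K t x)))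
    (hw0 : ∀ K, 0 ≤ w K) (hws : Summable w) (hr0 : ∀ K, 0 ≤ r K) (hrs : Summable r)
    (hmA : ∀ (K : ℕ) (t : ℝ), |t| ≤ 1 →
      ∑ u ∈ classSetK₁₃ θ K₀ g₀ (kr F θ hP g₀ os) K,
          max 0 (weightAK₁₃ θ hP K₀ g₀ os (kr F θ hP g₀ os) K t u - Real.exp (-c K) * weightBK₁₃ θ hP K₀ g₀ os (kr F θ hP g₀ os) K t u)
        ≤ w K * ∑ u ∈ classSetK₁₃ θ K₀ g₀ (kr F θ hP g₀ os) K, weightAK₁₃ θ hP K₀ g₀ os (kr F θ hP g₀ os) K t u)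
    (hmB : ∀ (K : ℕ) (t : ℝ), |t| ≤ 1 →
      ∑ u ∈ classSetK₁₃ θ K₀ g₀ (kr F θ hP g₀ os) K,
          max 0 (weightBK₁₃ θ hP K₀ g₀ os (kr F θ hP g₀ os) K t u - Real.exp (c K) * weightAK₁₃ θ hP K₀ g₀ os (kr F θ hP g₀ os) K t u)
        ≤ w K * ∑ u ∈ classSetK₁₃ θ K₀ g₀ (kr F θ hP g₀ os) K, weightBK₁₃ θ hP K₀ g₀ os (kr F θ hP g₀ os) K t u)
    (hZA : ∀ (K : ℕ) (t : ℝ), |t| ≤ 1 → 0 < ∑ x ∈ classSet₁₃ θ K₀ g₀ K, weightA₁₃ θ hP K₀ g₀ os K t x)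
    (hZB : ∀ (K : ℕ) (t : ℝ), |t| ≤ 1 → 0 < ∑ x ∈ classSet₁₃ θ K₀ g₀ K, weightB₁₃ θ hP K₀ g₀ os K t x)
    (hTV : ∀ (K : ℕ) (t : ℝ), |t| ≤ 1 → ∀ S' ⊆ classSet₁₃ θ K₀ g₀ K,
      |(∑ x ∈ S', weightA₁₃ θ hP K₀ g₀ os K t x) / (∑ x ∈ classSet₁₃ θ K₀ g₀ K, weightA₁₃ θ hP K₀ g₀ os K t x) -
        (∑ x ∈ S', weightB₁₃ θ hP K₀ g₀ os K t x) / (∑ x ∈ classSet₁₃ θ K₀ g₀ K, weightB₁₃ θ hP K₀ g₀ os K t x)| ≤ r K) :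
    ShellWeightBound (crOfRecord₁₃VAt K₀ jcut sh F θ hP g₀ os).l₀ (crOfRecord₁₃VAt K₀ jcut sh F θ hP g₀ os).T (crOfRecord₁₃VAt K₀ jcut sh F θ hP g₀ os).A
      (crOfRecord₁₃VAt K₀ jcut sh F θ hP g₀ os).B (crOfRecord₁₃VAt K₀ jcut sh F θ hP g₀ os).shA (crOfRecord₁₃VAt K₀ jcut sh F θ hP g₀ os).shB
      (crOfRecord₁₃VAt K₀ jcut sh F θ hP g₀ os).Wsh :=
  shellWeightBound_crOfRecord₁₃VAt_optShell_of_keyReading_of_fibreDev K₀ kr θ hP g₀ os jcut sh c hsh hw0 hws (fun K => by linarith [hr0 K]) (hrs.mul_left 2)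
    hmA hmB (fun K t ht => fibreDevA_record_le_of_classLawTV K₀ kr θ hP g₀ os (hZA K t ht) (hZB K t ht) (hTV K t ht))
    (fun K t ht => fibreDevB_record_le_of_classLawTV K₀ kr θ hP g₀ os (hZA K t ht) (hZB K t ht) (hTV K t ht))

end Record

end Summit.QuantumFields.YangMills.BalabanUVNodes.N20CoreEdgeShellDialDeviationTower

end
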